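import Mathlib
import Literature.Computability.AlgebraicComplexity.MatMulRankLowerBoundsProofs
import Literature.Computability.AlgebraicComplexity.BorderRankSkewCW
import Summits.MatrixMultiplication.MatrixMultiplication.Theorems.FidelityWitnessesDiagonalPowerDecayKoszulWitnessFrame

/-!
# Koszul witness for `DiagonalPowerDecay` (stmt-MatrixMultiplication-14053), part 2: the block flattening

The `p = 1` Koszul flattening of a tensor `t` after a projection `Ψ : ℂ^ι → ℂ³` of the first factor, in
the `3 × 3` block form `kwM Ψ t = koszulBlock₁ (Ψ-slices of t)` (rows `Fin 3 × μ`, columns `Fin 3 × κ`;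
Strassen's commutator equations in Ottaviani's form), and what the witness needs about it:

* `kwM_rank_le` — `rank (kwM Ψ t) ≤ 2·R(t)` (Landsberg–Ottaviani, from the tree's
  `LandsbergOttaviani2015_rank_koszulFlattening_le` via `koszulFlattening_one_submatrix`);
* `kwM_inner` — the Hilbert–Schmidt pairing of two flattenings is `2·∑_{b,c} ⟨Ψ t₁(·,b,c), Ψ t₂(·,b,c)⟩`
  (each coordinate of `ℂ³` occurs in exactly two entries of `e ∧ ·`);
* `sum_conj_mul_kwM_matMul` — the row functional `q ↦ ∑_r conj(f r) K(r,q)` of the flattened matrix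
  multiplication tensor `K = kwM C.mulVecLin ⟨n,n,n⟩` in closed form (table `kwTab`), and
* `sum_normSq_col_twirl` — for the twirled projections `Φ_w = kwProj w` of part 1 the column norms of that
  functional do not depend on `w`: `∑_κ |(f̄ᵀK_w)(i,(κ,μ))|² = ∑_κ |G₀(f;i,κ,μ)|²` with `G₀ = kwG0` the
  untwirled functional (coefficients `β`), because `W_w` acts unitarily on the column index `κ`
  (`kwShift_sum_normSq`).

References: J. M. Landsberg, G. Ottaviani, Theory of Computing 11 (2015), §2 and Thm 2.1; V. Strassen,
J. reine angew. Math. 375/376 (1987); A. Conner, F. Gesmundo, J. M. Landsberg, E. Ventura (2022), §4.1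
(the `p = 1` block form).
-/

set_option linter.dupNamespace false

noncomputable section

namespace Summit.MatrixMultiplication.MatrixMultiplication.Theorems.DiagonalPowerDecay

open scoped BigOperators ComplexConjugate InnerProductSpace
open Literature.Computability.AlgebraicComplexity

/-! ## The block flattening `kwM Ψ t`, its rank and its Hilbert–Schmidt pairing -/

section General

variable {ι κ μ : Type*}

/-- The `p = 1` Koszul flattening of `t` after `Ψ` on the first factor, in `3 × 3` block form
(`koszulBlock₁` of the `Ψ`-slices `(j, b, c) ↦ Ψ(t(·,b,c))_j`). [cite: LandsbergOttaviani2015, §2 (T_A^{∧p})] -/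
def kwM (Ψ : (ι → ℂ) →ₗ[ℂ] (Fin (2 * 1 + 1) → ℂ)) (t : ι → κ → μ → ℂ) :
    Matrix (Fin 3 × μ) (Fin 3 × κ) ℂ :=
  koszulBlock₁ fun j b c => Ψ (fun a => t a b c) j

/-- Entries of `kwM` (the `3 × 3` block table). [folklore] -/
theorem kwM_apply (Ψ : (ι → ℂ) →ₗ[ℂ] (Fin (2 * 1 + 1) → ℂ)) (t : ι → κ → μ → ℂ)
    (r : Fin 3 × μ) (c : Fin 3 × κ) :
    kwM Ψ t r c =
      ![![0, -Ψ (fun a => t a c.2 r.2) 2, Ψ (fun a => t a c.2 r.2) 1],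
        ![-Ψ (fun a => t a c.2 r.2) 2, 0, Ψ (fun a => t a c.2 r.2) 0],
        ![-Ψ (fun a => t a c.2 r.2) 1, Ψ (fun a => t a c.2 r.2) 0, 0]] r.1 c.1 := rfl

/-- **`rank (kwM Ψ t) ≤ 2·R(t)`** (Landsberg–Ottaviani: each triad contributes rank `C(2,1) = 2`).
[cite: LandsbergOttaviani2015, Thm 2.1 (proof)] -/
theorem kwM_rank_le [Fintype ι] [Fintype κ] [Fintype μ] [DecidableEq κ] [DecidableEq μ]
    (Ψ : (ι → ℂ) →ₗ[ℂ] (Fin (2 * 1 + 1) → ℂ)) (t : ι → κ → μ → ℂ) :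
    (kwM Ψ t).rank ≤ 2 * tensorRank t := by
  classical
  have h1 : kwM Ψ t = (koszulFlattening 1 LinearMap.id (fun j b c => Ψ (fun a => t a b c) j)).submatrix
      (fun r : Fin 3 × μ => (koszulRow₁ r.1, r.2)) (fun c : Fin 3 × κ => (koszulCol₁ c.1, c.2)) :=
    (koszulFlattening_one_submatrix _).symm
  have h2 : koszulFlattening 1 LinearMap.id (fun j b c => Ψ (fun a => t a b c) j) =
      koszulFlattening 1 Ψ t := by
    ext r c
    rfl
  rw [h1]
  refine (Matrix.rank_submatrix_le _ _ _).trans ?_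
  rw [h2]
  simpa using LandsbergOttaviani2015_rank_koszulFlattening_le 1 Ψ t

/-- **Hilbert–Schmidt pairing of two `p = 1` flattenings**: each coordinate of `ℂ³` sits in exactly two
entries of `e ∧ · : Λ¹ → Λ²`, so `⟨kwM Ψ t₁, kwM Ψ t₂⟩_HS = 2 ∑_{b,c} ∑_j conj(Ψ t₁(·,b,c))_j (Ψ t₂(·,b,c))_j`.
[folklore] -/
theorem kwM_inner [Fintype κ] [Fintype μ] (Ψ : (ι → ℂ) →ₗ[ℂ] (Fin (2 * 1 + 1) → ℂ))
    (t₁ t₂ : ι → κ → μ → ℂ) :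
    ∑ r : Fin 3 × μ, ∑ c : Fin 3 × κ, conj (kwM Ψ t₁ r c) * kwM Ψ t₂ r c =
      2 * ∑ c : μ, ∑ b : κ, ∑ j : Fin (2 * 1 + 1),
        conj (Ψ (fun a => t₁ a b c) j) * Ψ (fun a => t₂ a b c) j := by
  -- pointwise `3 × 3` computation
  have key : ∀ (b : κ) (c : μ), ∑ p : Fin 3, ∑ i : Fin 3,
      conj (kwM Ψ t₁ (p, c) (i, b)) * kwM Ψ t₂ (p, c) (i, b) =
      2 * ∑ j : Fin (2 * 1 + 1), conj (Ψ (fun a => t₁ a b c) j) * Ψ (fun a => t₂ a b c) j := by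
    intro b c
    rw [Fin.sum_univ_three, Fin.sum_univ_three, Fin.sum_univ_three, Fin.sum_univ_three,
      Fin.sum_univ_three]
    simp only [kwM_apply, Matrix.cons_val_zero, Matrix.cons_val_one, Matrix.cons_val_two,
      Matrix.head_cons, Matrix.tail_cons, map_zero, zero_mul, map_neg, neg_mul_neg]
    ring
  rw [Fintype.sum_prod_type, Finset.sum_comm, Finset.mul_sum]
  refine Finset.sum_congr rfl fun c _ => ?_
  have h1 : ∀ p : Fin 3, ∑ x : Fin 3 × κ, conj (kwM Ψ t₁ (p, c) x) * kwM Ψ t₂ (p, c) x =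
      ∑ b : κ, ∑ i : Fin 3, conj (kwM Ψ t₁ (p, c) (i, b)) * kwM Ψ t₂ (p, c) (i, b) := by
    intro p
    rw [Fintype.sum_prod_type, Finset.sum_comm]
  simp_rw [h1]
  rw [Finset.sum_comm, Finset.mul_sum]
  refine Finset.sum_congr rfl fun b _ => ?_
  rw [← key b c, Finset.sum_comm]

end General

/-! ## The flattened matrix multiplication tensor -/

section MatMul

variable {n : ℕ}

/-- The table of coefficients of the row functional `f ↦ (q ↦ ∑_r conj(f r) K(r,q))` of a `p = 1`
block flattening: for column block `i` and coordinate `j` of `ℂ³`, the conjugated row entry that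
multiplies `t_j` (`[[0,-f̄₂,-f̄₁],[f̄₂,0,-f̄₀],[f̄₁,f̄₀,0]]`). [folklore] -/
def kwTab (f : Fin 3 → ℂ) : Fin 3 → Fin (2 * 1 + 1) → ℂ :=
  ![![0, -conj (f 2), -conj (f 1)], ![conj (f 2), 0, -conj (f 0)], ![conj (f 1), conj (f 0), 0]]

/-- Column `(i, b)` of `f̄ᵀ · kwM Ψ t`: `∑_r conj(f r) (kwM Ψ t) r (i,b) = ∑_c ∑_j kwTab(f(·,c)) i j · Ψ(t(·,b,c))_j`.
[folklore] -/
theorem sum_conj_mul_kwM {ι κ μ : Type*} [Fintype μ] (Ψ : (ι → ℂ) →ₗ[ℂ] (Fin (2 * 1 + 1) → ℂ))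
    (t : ι → κ → μ → ℂ) (f : Fin 3 × μ → ℂ) (i : Fin 3) (b : κ) :
    ∑ r : Fin 3 × μ, conj (f r) * kwM Ψ t r (i, b) =
      ∑ c : μ, ∑ j : Fin (2 * 1 + 1), kwTab (fun p => f (p, c)) i j * Ψ (fun a => t a b c) j := by
  rw [Fintype.sum_prod_type, Finset.sum_comm]
  refine Finset.sum_congr rfl fun c _ => ?_
  rw [Fin.sum_univ_three, Fin.sum_univ_three]
  fin_cases i <;>
    simp [kwM_apply, kwTab, Matrix.cons_val_zero, Matrix.cons_val_one, Matrix.cons_val_two,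
      Matrix.head_cons, Matrix.tail_cons] <;> ring

/-- The `Ψ`-slices of `⟨n,n,n⟩` for `Ψ = C.mulVecLin`: `Ψ(⟨n,n,n⟩(·,(κ,μ'),(μ,ν)))_j = [μ' = μ]·C(j,(κ,ν))`.
[cite: Blaser2013, §5 (the tensor ⟨k,m,n⟩)] -/
theorem mulVecLin_matMulTensor_slice (C : Matrix (Fin (2 * 1 + 1)) (Fin n × Fin n) ℂ)
    (b c : Fin n × Fin n) (j : Fin (2 * 1 + 1)) :
    C.mulVecLin (fun a => matMulTensor ℂ n n n a b c) j = if b.2 = c.1 then C j (b.1, c.2) else 0 := by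
  classical
  have hs := matMulTensor_slice ℂ n n b.1 c.2 b.2 c.1
  simp only [Prod.mk.eta] at hs
  rw [hs]
  split_ifs with h
  · rw [Matrix.mulVecLin_apply, Matrix.mulVec_single_one]
    rfl
  · simp

/-- Column `(i,(κ,μ))` of `f̄ᵀ · kwM C.mulVecLin ⟨n,n,n⟩` in closed form:
`∑_ν ∑_j kwTab(f(·,(μ,ν))) i j · C(j,(κ,ν))`. [folklore] -/
theorem sum_conj_mul_kwM_matMul (C : Matrix (Fin (2 * 1 + 1)) (Fin n × Fin n) ℂ)
    (f : Fin 3 × (Fin n × Fin n) → ℂ) (i : Fin 3) (κ μ : Fin n) :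
    ∑ r : Fin 3 × (Fin n × Fin n), conj (f r) * kwM C.mulVecLin (matMulTensor ℂ n n n) r (i, (κ, μ)) =
      ∑ ν : Fin n, ∑ j : Fin (2 * 1 + 1), kwTab (fun p => f (p, (μ, ν))) i j * C j (κ, ν) := by
  classical
  rw [sum_conj_mul_kwM, Fintype.sum_prod_type]
  simp_rw [mulVecLin_matMulTensor_slice]
  simp only [mul_ite, mul_zero]
  rw [Finset.sum_eq_single μ]
  · simp
  · intro μ' _ hμ'
    simp [Ne.symm hμ']
  · intro h; exact absurd (Finset.mem_univ μ) h

/-- `∑_κ ‖∑_κ₀ W_w(κ₀,κ) h(κ₀)‖² = ∑_κ₀ ‖h(κ₀)‖²`: the rows of `W_w` are orthonormal. [folklore] -/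
theorem kwShift_sum_normSq [NeZero n] (w : Fin n × Fin n) (h : Fin n → ℂ) :
    ∑ κ, ‖∑ κ₀, kwShift w κ₀ κ * h κ₀‖ ^ 2 = ∑ κ₀, ‖h κ₀‖ ^ 2 := by
  classical
  apply Complex.ofReal_injective
  push_cast
  have hsq : ∀ z : ℂ, ((‖z‖ : ℝ) : ℂ) ^ 2 = z * conj z := fun z => by
    rw [Complex.mul_conj']
  simp_rw [hsq, map_sum, map_mul, Finset.sum_mul_sum]
  -- ∑_κ ∑_κ₀ ∑_κ₁ W h conj(W h) = ∑_κ₀ ∑_κ₁ h conj h ∑_κ W conj W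
  calc ∑ κ, ∑ κ₀, ∑ κ₁, kwShift w κ₀ κ * h κ₀ * (conj (kwShift w κ₁ κ) * conj (h κ₁))
      = ∑ κ₀, ∑ κ₁, h κ₀ * conj (h κ₁) * ∑ κ, kwShift w κ₀ κ * conj (kwShift w κ₁ κ) := by
        rw [Finset.sum_comm]
        refine Finset.sum_congr rfl fun κ₀ _ => ?_
        rw [Finset.sum_comm]
        refine Finset.sum_congr rfl fun κ₁ _ => ?_
        rw [Finset.mul_sum]
        exact Finset.sum_congr rfl fun κ _ => by ring
    _ = ∑ κ₀, h κ₀ * conj (h κ₀) := by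
        refine Finset.sum_congr rfl fun κ₀ _ => ?_
        simp_rw [kwShift_row_orthonormal]
        simp

/-- The row functional of the untwirled flattening `K_0` at column `(i,(κ,μ))`:
`G₀(f; i, κ, μ) = ∑_ν ∑_j kwTab(f(·,(μ,ν))) i j · β_j(κ,ν)`. [folklore] -/
def kwG0 (f : Fin 3 × (Fin n × Fin n) → ℂ) (i : Fin 3) (κ μ : Fin n) : ℂ :=
  ∑ ν : Fin n, ∑ j : Fin (2 * 1 + 1), kwTab (fun p => f (p, (μ, ν))) i j * kwBeta κ ν j

/-- The twirl acts on the columns of the flattened `⟨n,n,n⟩` by the unitary `W_w`: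
`∑_κ ‖(f̄ᵀ K_w)(i,(κ,μ))‖² = ∑_κ ‖(f̄ᵀ K_0)(i,(κ,μ))‖²` with `K_0` the untwirled flattening
(coefficients `β`). [folklore] -/
theorem sum_normSq_col_twirl {n : ℕ} [NeZero n] (w : Fin n × Fin n) (f : Fin 3 × (Fin n × Fin n) → ℂ)
    (i : Fin 3) (μ : Fin n) :
    ∑ κ, ‖∑ r : Fin 3 × (Fin n × Fin n), conj (f r) * kwM (kwProj w) (matMulTensor ℂ n n n) r (i, (κ, μ))‖ ^ 2 =
      ∑ κ, ‖kwG0 f i κ μ‖ ^ 2 := by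
  classical
  unfold kwG0
  have h1 : ∀ κ, ∑ r : Fin 3 × (Fin n × Fin n), conj (f r) * kwM (kwProj w) (matMulTensor ℂ n n n) r (i, (κ, μ)) =
      ∑ κ₀, kwShift w κ₀ κ * ∑ ν : Fin n, ∑ j : Fin (2 * 1 + 1), kwTab (fun p => f (p, (μ, ν))) i j * kwBeta κ₀ ν j := by
    intro κ
    rw [kwProj, sum_conj_mul_kwM_matMul]
    simp_rw [kwCoeff_apply]
    calc ∑ ν : Fin n, ∑ j : Fin (2 * 1 + 1), kwTab (fun p => f (p, (μ, ν))) i j *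
            ∑ κ₀, kwBeta κ₀ ν j * kwShift w κ₀ κ
        = ∑ ν : Fin n, ∑ j : Fin (2 * 1 + 1), ∑ κ₀,
            kwShift w κ₀ κ * (kwTab (fun p => f (p, (μ, ν))) i j * kwBeta κ₀ ν j) := by
          refine Finset.sum_congr rfl fun ν _ => Finset.sum_congr rfl fun j _ => ?_
          rw [Finset.mul_sum]
          exact Finset.sum_congr rfl fun κ₀ _ => by ring
      _ = ∑ κ₀, ∑ ν : Fin n, ∑ j : Fin (2 * 1 + 1),
            kwShift w κ₀ κ * (kwTab (fun p => f (p, (μ, ν))) i j * kwBeta κ₀ ν j) := by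
          have hc : ∀ ν : Fin n, (∑ j : Fin (2 * 1 + 1), ∑ κ₀,
              kwShift w κ₀ κ * (kwTab (fun p => f (p, (μ, ν))) i j * kwBeta κ₀ ν j)) =
              ∑ κ₀, ∑ j : Fin (2 * 1 + 1),
                kwShift w κ₀ κ * (kwTab (fun p => f (p, (μ, ν))) i j * kwBeta κ₀ ν j) :=
            fun ν => Finset.sum_comm
          simp_rw [hc]
          exact Finset.sum_comm
      _ = ∑ κ₀, kwShift w κ₀ κ * ∑ ν : Fin n, ∑ j : Fin (2 * 1 + 1),
            kwTab (fun p => f (p, (μ, ν))) i j * kwBeta κ₀ ν j := by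
          refine Finset.sum_congr rfl fun κ₀ _ => ?_
          rw [Finset.mul_sum]
          exact Finset.sum_congr rfl fun ν _ => by rw [Finset.mul_sum]
  simp_rw [h1]
  exact kwShift_sum_normSq w _

end MatMul

end Summit.MatrixMultiplication.MatrixMultiplication.Theorems.DiagonalPowerDecay

end
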